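import Literature.Computability.AlgebraicComplexity.BigCwSquareFamilyValue
import Literature.Computability.AlgebraicComplexity.BigCwSquareFormatValueMatrix
import HarnessLib

/-!
# Level 2 of the saturation ladder — I: the valued word over `CW_5^{⊗2}`
# (route `SaturationLadder`, lens 1, gen 21)

Cell `decomp-mm`, lens 1 («grading / quantitative ladder»), gen 21, part 1 of 2.  No named facts,
no sorry; the definitions are the explicit design (two words).  Level 1 of the ladder (the
Coppersmith–Winograd tensors `CW_q` with pooled designs, gen 20) is capped at Coppersmith's
`α = 0.29462…` (tree: `alpha_ge_5_17`).  Level 2 is the SQUARE `CW_q^{⊗2}` analysed as a tensor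
with `15` components (Le Gall 2012, §3 and §6): twelve matrix products
(`BigCwSquareFormatValueMatrix`) and the family `[112], [121], [211]`, whose inner extractions must
be valued JOINTLY for rectangular formats (Le Gall 2012, Prop. 6.2) — in the tree's currency the
nested pooling `hasFormatValue_laserBlock_cwSqFamWord` (`BigCwSquareFamilyValue`).

This file builds the ONE VALUED WORD on which part 2 (`SaturationLadderLevelTwo`) runs the outer
laser method (`laserMethod_hasFormatValue_of_wordValue`): `lvl2Word` of length `2254 = 46 · 49`
over the level-2 support lists the twelve matrix letters as constant runs (counts `400:46, 040:2,
004:2, 310:230, 130:17, 220:408, 301:230, 103:17, 202:408, 031:3, 013:3, 022:36`) followed by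
`213` repetitions of the family word `([112],[121],[211],[211])` (inner splitting `τ = 25/27` of
`[211]`), and computes its letter counts and its block format value
`(V; X, Y, X)` with `V = (2^{2+2H₃})^{213}`, `X = 10^{247} 27^{408} (5^{77/27})^{213}`,
`Y = 10^6 27^{36} (5^{58/27})^{213}` at `q = 5` (`2q = 10`, `q² + 2 = 27`;
`H₃ = (2η(1/27) + η(25/27))/ln 2`, `2H₃ ≤ 1` by the integer certificate `27^54 ≤ 2^27 · 25^50`).

## References

* F. Le Gall, *Faster algorithms for rectangular matrix multiplication*, FOCS 2012,
  arXiv:1204.1111, §3, §6.1, Prop. 6.2. [LeGall2012]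
* D. Coppersmith, S. Winograd, *Matrix multiplication via arithmetic progressions*,
  J. Symbolic Comput. 9 (1990), §8. [CoppersmithWinograd1990]
* D. Coppersmith, *Rectangular matrix multiplication revisited*, J. Complexity 13 (1997), §3.
  [Coppersmith1997]
-/

set_option linter.dupNamespace false
set_option autoImplicit false
set_option exponentiation.threshold 100000
set_option maxRecDepth 100000

noncomputable section

open Finset Real
open scoped BigOperators

namespace Summit.MatrixMultiplication.MatrixMultiplication.Theorems.SaturationLadderLevelTwo

open Literature.Computability.AlgebraicComplexity

/-- The level-2 label set `{0,…,4}³`. [folklore] -/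
abbrev PL5 := Fin 5 × Fin 5 × Fin 5

/-! ## Generic helpers -/

/-- Letters of a concatenation lie in `S` if those of both words do. [folklore] -/
theorem append_mem {α : Type} {S : Finset α} {m n : ℕ} {w : Fin m → α} {w' : Fin n → α}
    (hw : ∀ ρ, w ρ ∈ S) (hw' : ∀ ρ, w' ρ ∈ S) : ∀ ρ, Fin.append w w' ρ ∈ S :=
  fun ρ => by
  induction ρ using Fin.addCases with
  | left i => rw [Fin.append_left]; exact hw i
  | right j => rw [Fin.append_right]; exact hw' j

/-- Letters of a repetition lie in `S` if those of the word do. [folklore] -/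
theorem repWord_mem {α : Type} [DecidableEq α] {S : Finset α} {d : ℕ} {w : Fin d → α}
    (hw : ∀ ρ, w ρ ∈ S) (M : ℕ) :
    ∀ ρ, repWord w M ρ ∈ S := fun ρ => by
  rw [repWord_apply]; exact hw _

/-- Letters of a constant word. [folklore] -/
theorem const_mem {α : Type} {S : Finset α} {a : α} (ha : a ∈ S) (n : ℕ) :
    ∀ ρ : Fin n, (fun _ : Fin n => a) ρ ∈ S := fun _ => ha

/-! ## The level-2 data at `q = 5` -/

/-- The laser block of a word over the level-2 labels, for `CW_5^{⊗2}` over `ℂ`. [folklore] -/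
abbrev blockOf {d : ℕ} (w : Fin d → PL5) :=
  laserBlock cwLev2 cwLev2 cwLev2 (bigCwSq ℂ 5) w

/-- A constant run of a component with format value `(1; A, B, C)` is worth `(1; Aⁿ, Bⁿ, Cⁿ)`.
[folklore] -/
theorem blk (s : PL5) (n : ℕ) {A B C : ℝ}
    (h : HasFormatValue (cwSqComp ℂ 5 s.1 s.2.1 s.2.2) 1 A B C)
    (hA : 0 ≤ A := by positivity) (hB : 0 ≤ B := by positivity)
    (hC : 0 ≤ C := by positivity) :
    HasFormatValue (blockOf (fun _ : Fin n => s)) 1 (A ^ n) (B ^ n) (C ^ n) := by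
  simpa using h.laserBlock_const cwLev2 cwLev2 cwLev2 (bigCwSq ℂ 5) zero_le_one hA hB hC n

/-- Concatenation multiplies format values (value `1`). [folklore] -/
theorem app {m n : ℕ} {w : Fin m → PL5} {w' : Fin n → PL5} {A B C A' B' C' : ℝ}
    (h : HasFormatValue (blockOf w) 1 A B C) (h' : HasFormatValue (blockOf w') 1 A' B' C')
    (hA : 0 ≤ A := by positivity) (hA' : 0 ≤ A' := by positivity)
    (hB : 0 ≤ B := by positivity) (hB' : 0 ≤ B' := by positivity)
    (hC : 0 ≤ C := by positivity) (hC' : 0 ≤ C' := by positivity) :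
    HasFormatValue (blockOf (Fin.append w w')) 1 (A * A') (B * B') (C * C') := by
  simpa using h.laserBlock_append cwLev2 cwLev2 cwLev2 (bigCwSq ℂ 5) h' zero_le_one zero_le_one
    hA hA' hB hB' hC hC'

/-- **The matrix part of the design**: the twelve matrix letters of `CW_5^{⊗2}` as constant runs
with counts `400:46, 040:2, 004:2, 310:230, 130:17, 220:408, 301:230, 103:17, 202:408, 031:3,
013:3, 022:36` (total `1402`). [folklore] -/
def matWord : Fin 1402 → PL5 :=
  Fin.append (fun _ : Fin 46 => ((4 : Fin 5), (0 : Fin 5), (0 : Fin 5))) <|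
  Fin.append (fun _ : Fin 2 => ((0 : Fin 5), (4 : Fin 5), (0 : Fin 5))) <|
  Fin.append (fun _ : Fin 2 => ((0 : Fin 5), (0 : Fin 5), (4 : Fin 5))) <|
  Fin.append (fun _ : Fin 230 => ((3 : Fin 5), (1 : Fin 5), (0 : Fin 5))) <|
  Fin.append (fun _ : Fin 17 => ((1 : Fin 5), (3 : Fin 5), (0 : Fin 5))) <|
  Fin.append (fun _ : Fin 408 => ((2 : Fin 5), (2 : Fin 5), (0 : Fin 5))) <|
  Fin.append (fun _ : Fin 230 => ((3 : Fin 5), (0 : Fin 5), (1 : Fin 5))) <|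
  Fin.append (fun _ : Fin 17 => ((1 : Fin 5), (0 : Fin 5), (3 : Fin 5))) <|
  Fin.append (fun _ : Fin 408 => ((2 : Fin 5), (0 : Fin 5), (2 : Fin 5))) <|
  Fin.append (fun _ : Fin 3 => ((0 : Fin 5), (3 : Fin 5), (1 : Fin 5))) <|
  Fin.append (fun _ : Fin 3 => ((0 : Fin 5), (1 : Fin 5), (3 : Fin 5)))
    (fun _ : Fin 36 => ((0 : Fin 5), (2 : Fin 5), (2 : Fin 5)))

/-- **The level-2 word** (`d = 2254 = 46 · 49`): the matrix part followed by `213` repetitions of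
the family word `([112],[121],[211],[211])`. [folklore] -/
def lvl2Word : Fin 2254 → PL5 := Fin.append matWord (repWord cwSqFamWord 213)

/-- The letters of the matrix part lie in the level-2 support. [folklore] -/
theorem matWord_mem : ∀ ρ, matWord ρ ∈ cwSupport₂ := by
  have h := append_mem
    (const_mem (S := cwSupport₂) (a := ((4 : Fin 5), (0 : Fin 5), (0 : Fin 5)))
      (by simp [mem_cwSupport₂]) 46)
    (append_mem
    (const_mem (S := cwSupport₂) (a := ((0 : Fin 5), (4 : Fin 5), (0 : Fin 5)))
      (by simp [mem_cwSupport₂]) 2)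
    (append_mem
    (const_mem (S := cwSupport₂) (a := ((0 : Fin 5), (0 : Fin 5), (4 : Fin 5)))
      (by simp [mem_cwSupport₂]) 2)
    (append_mem
    (const_mem (S := cwSupport₂) (a := ((3 : Fin 5), (1 : Fin 5), (0 : Fin 5)))
      (by simp [mem_cwSupport₂]) 230)
    (append_mem
    (const_mem (S := cwSupport₂) (a := ((1 : Fin 5), (3 : Fin 5), (0 : Fin 5)))
      (by simp [mem_cwSupport₂]) 17)
    (append_mem
    (const_mem (S := cwSupport₂) (a := ((2 : Fin 5), (2 : Fin 5), (0 : Fin 5)))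
      (by simp [mem_cwSupport₂]) 408)
    (append_mem
    (const_mem (S := cwSupport₂) (a := ((3 : Fin 5), (0 : Fin 5), (1 : Fin 5)))
      (by simp [mem_cwSupport₂]) 230)
    (append_mem
    (const_mem (S := cwSupport₂) (a := ((1 : Fin 5), (0 : Fin 5), (3 : Fin 5)))
      (by simp [mem_cwSupport₂]) 17)
    (append_mem
    (const_mem (S := cwSupport₂) (a := ((2 : Fin 5), (0 : Fin 5), (2 : Fin 5)))
      (by simp [mem_cwSupport₂]) 408)
    (append_mem
    (const_mem (S := cwSupport₂) (a := ((0 : Fin 5), (3 : Fin 5), (1 : Fin 5)))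
      (by simp [mem_cwSupport₂]) 3)
    (append_mem
    (const_mem (S := cwSupport₂) (a := ((0 : Fin 5), (1 : Fin 5), (3 : Fin 5)))
      (by simp [mem_cwSupport₂]) 3)
    ((const_mem (S := cwSupport₂) (a := ((0 : Fin 5), (2 : Fin 5), (2 : Fin 5)))
      (by simp [mem_cwSupport₂]) 36))))))))))))
  exact h

/-- The letters of the family repetitions lie in the level-2 support. [folklore] -/
theorem famRep_mem : ∀ ρ, repWord cwSqFamWord 213 ρ ∈ cwSupport₂ := by
  refine repWord_mem (fun ρ => ?_) 213
  have h := cwSqFamWord_mem ρ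
  simp only [Finset.mem_insert, Finset.mem_singleton] at h
  rcases h with h | h | h <;> rw [h] <;> simp [mem_cwSupport₂]

/-- The letters of the level-2 word lie in the level-2 support. [folklore] -/
theorem lvl2Word_mem : ∀ ρ, lvl2Word ρ ∈ cwSupport₂ := by
  unfold lvl2Word
  exact append_mem matWord_mem famRep_mem

/-- **The letter counts of the level-2 word.** [folklore] -/
theorem letterCount_lvl2Word (s : PL5) : letterCount lvl2Word s =
    (if s = (4, 0, 0) then 46 else 0) + ((if s = (0, 4, 0) then 2 else 0) +
    ((if s = (0, 0, 4) then 2 else 0) + ((if s = (3, 1, 0) then 230 else 0) +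
    ((if s = (1, 3, 0) then 17 else 0) + ((if s = (2, 2, 0) then 408 else 0) +
    ((if s = (3, 0, 1) then 230 else 0) + ((if s = (1, 0, 3) then 17 else 0) +
    ((if s = (2, 0, 2) then 408 else 0) + ((if s = (0, 3, 1) then 3 else 0) +
    ((if s = (0, 1, 3) then 3 else 0) + (if s = (0, 2, 2) then 36 else 0))))))))))) +
    213 * ((if s = (1, 1, 2) then 1 else 0) + (if s = (1, 2, 1) then 1 else 0) +
      (if s = (2, 1, 1) then 2 else 0)) := by
  simp only [lvl2Word, matWord, letterCount_append, Pi.add_apply, letterCount_const,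
    letterCount_repWord, letterCount_cwSqFamWord]

/-! ## The block value of the word -/

/-- **The matrix part is worth `(1; 10^247·27^408, 10^6·27^36, 10^247·27^408)`** (products of
the twelve matrix format values `(1; cwSqFmtA, cwSqFmtB, cwSqFmtC)` at `q = 5`: `2q = 10`,
`q²+2 = 27`). [cite: LeGall2012, §3 and §6.1] [cite: CoppersmithWinograd1990, §8] -/
theorem hasFormatValue_matWord : HasFormatValue (blockOf matWord) 1 ((10 : ℝ) ^ 247 * 27 ^ 408)
    ((10 : ℝ) ^ 6 * 27 ^ 36) ((10 : ℝ) ^ 247 * 27 ^ 408) := by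
  have h400 : HasFormatValue (cwSqComp ℂ 5 4 0 0) 1 1 1 1 := hasFormatValue_cwSqComp400 ℂ 5
  have h040 : HasFormatValue (cwSqComp ℂ 5 0 4 0) 1 1 1 1 := hasFormatValue_cwSqComp040 ℂ 5
  have h004 : HasFormatValue (cwSqComp ℂ 5 0 0 4) 1 1 1 1 := hasFormatValue_cwSqComp004 ℂ 5
  have h310 : HasFormatValue (cwSqComp ℂ 5 3 1 0) 1 10 1 1 := by
    have h := hasFormatValue_cwSqComp310 ℂ 5; norm_num at h; exact h
  have h130 : HasFormatValue (cwSqComp ℂ 5 1 3 0) 1 10 1 1 := by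
    have h := hasFormatValue_cwSqComp130 ℂ 5; norm_num at h; exact h
  have h220 : HasFormatValue (cwSqComp ℂ 5 2 2 0) 1 27 1 1 := by
    have h := hasFormatValue_cwSqComp220 ℂ 5; norm_num at h; exact h
  have h301 : HasFormatValue (cwSqComp ℂ 5 3 0 1) 1 1 1 10 := by
    have h := hasFormatValue_cwSqComp301 ℂ 5; norm_num at h; exact h
  have h103 : HasFormatValue (cwSqComp ℂ 5 1 0 3) 1 1 1 10 := by
    have h := hasFormatValue_cwSqComp103 ℂ 5; norm_num at h; exact h
  have h202 : HasFormatValue (cwSqComp ℂ 5 2 0 2) 1 1 1 27 := by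
    have h := hasFormatValue_cwSqComp202 ℂ 5; norm_num at h; exact h
  have h031 : HasFormatValue (cwSqComp ℂ 5 0 3 1) 1 1 10 1 := by
    have h := hasFormatValue_cwSqComp031 ℂ 5; norm_num at h; exact h
  have h013 : HasFormatValue (cwSqComp ℂ 5 0 1 3) 1 1 10 1 := by
    have h := hasFormatValue_cwSqComp013 ℂ 5; norm_num at h; exact h
  have h022 : HasFormatValue (cwSqComp ℂ 5 0 2 2) 1 1 27 1 := by
    have h := hasFormatValue_cwSqComp022 ℂ 5; norm_num at h; exact h
  have h := app (blk (4, 0, 0) 46 h400) <| app (blk (0, 4, 0) 2 h040) <|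
    app (blk (0, 0, 4) 2 h004) <|
    app (blk (3, 1, 0) 230 h310) <| app (blk (1, 3, 0) 17 h130) <| app (blk (2, 2, 0) 408 h220) <|
    app (blk (3, 0, 1) 230 h301) <| app (blk (1, 0, 3) 17 h103) <| app (blk (2, 0, 2) 408 h202) <|
    app (blk (0, 3, 1) 3 h031) <| app (blk (0, 1, 3) 3 h013) (blk (0, 2, 2) 36 h022)
  unfold matWord
  convert h using 1 <;> (simp only [one_pow, one_mul, mul_one]; ring)

/-- **The inner splitting entropy** `H₃ = (2η(1/27) + η(25/27))/ln 2` of `[211]` at `τ = 25/27`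
(`η = negMulLog`). [folklore] -/
def H3 : ℝ := (2 * negMulLog ((1 : ℝ) / 27) + negMulLog ((25 : ℝ) / 27)) / Real.log 2

/-- `H₃ · ln 2 = ln 27 − (25/27) ln 25`. [folklore] -/
theorem H3_mul_log_two : H3 * Real.log 2 = Real.log 27 - 25 / 27 * Real.log 25 := by
  have hlog : Real.log 2 ≠ 0 := (Real.log_pos one_lt_two).ne'
  unfold H3
  rw [div_mul_cancel₀ _ hlog]
  simp only [Real.negMulLog]
  rw [Real.log_div (by norm_num) (by norm_num), Real.log_div (by norm_num) (by norm_num),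
    Real.log_one]
  ring

/-- Integer certificate: `27^54 ≤ 2^27 · 25^50` (`2H₃ ≤ 1`). [folklore] -/
theorem cert_inner : (27 : ℕ) ^ 54 ≤ 2 ^ 27 * 25 ^ 50 := by decide

/-- `2H₃ ≤ 1`: the pooled `x`-budget `2 + 2H₃` of the family does not exceed `3`.
[folklore] -/
theorem two_H3_le_one : 2 * H3 ≤ 1 := by
  have hlog : 0 < Real.log 2 := Real.log_pos one_lt_two
  have h : ((27 : ℕ) ^ 54 : ℝ) ≤ (2 : ℕ) ^ 27 * (25 : ℕ) ^ 50 := by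
    exact_mod_cast cert_inner
  push_cast at h
  have h' := Real.log_le_log (by positivity) h
  rw [Real.log_mul (by positivity) (by positivity)] at h'
  simp only [Real.log_pow, Nat.cast_ofNat] at h'
  have e := H3_mul_log_two
  refine le_of_mul_le_mul_right ?_ hlog
  have : 2 * H3 * Real.log 2 = 2 * (H3 * Real.log 2) := by ring
  rw [this, e, one_mul]
  have h25 : Real.log 25 = 2 * Real.log 5 := by
    rw [show (25 : ℝ) = 5 ^ 2 by norm_num, Real.log_pow]; norm_num
  linarith

/-- **The family repetitions are worth `((2^{2+2H₃})^{213}; (5^{77/27})^{213}, (5^{58/27})^{213},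
(5^{77/27})^{213})`** (Le Gall 2012 Prop. 6.2 in format currency, `τ = 25/27`, repeated).
[cite: LeGall2012, Prop. 6.2] -/
theorem hasFormatValue_famRep :
    HasFormatValue (blockOf (repWord cwSqFamWord 213)) (((2 : ℝ) ^ (2 + 2 * H3)) ^ 213)
      (((5 : ℝ) ^ ((77 : ℝ) / 27)) ^ 213) (((5 : ℝ) ^ ((58 : ℝ) / 27)) ^ 213)
      (((5 : ℝ) ^ ((77 : ℝ) / 27)) ^ 213) := by
  have h := hasFormatValue_laserBlock_cwSqFamWord ℂ 5 (by norm_num) (a := 2) (b := 25)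
    (by norm_num) (by norm_num) (τ := 25 / 27) (by norm_num)
  have e1 : (1 - (25 : ℝ) / 27) / 2 = 1 / 27 := by norm_num
  have e2 : (1 : ℝ) + 2 * (25 / 27) = 77 / 27 := by norm_num
  have e3 : (4 : ℝ) - 2 * (25 / 27) = 58 / 27 := by norm_num
  have e4 : (2 * negMulLog ((1 : ℝ) / 27) + negMulLog ((25 : ℝ) / 27)) / Real.log 2 = H3 := rfl
  have hmin : min (2 + 2 * H3) 3 = 2 + 2 * H3 := min_eq_left (by linarith [two_H3_le_one])
  rw [e1, e2, e3, e4, hmin] at h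
  have h5 : (0 : ℝ) ≤ (5 : ℕ) := by norm_num
  exact h.laserBlock_repWord cwLev2 cwLev2 cwLev2 (bigCwSq ℂ 5) (by positivity)
    (Real.rpow_nonneg h5 _) (Real.rpow_nonneg h5 _) (Real.rpow_nonneg h5 _) 213

/-- The total `x`- (and `z`-) format of the word. [folklore] -/
def Xtot : ℝ := (10 : ℝ) ^ 247 * 27 ^ 408 * (((5 : ℝ) ^ ((77 : ℝ) / 27)) ^ 213)

/-- The total `y`-format of the word. [folklore] -/
def Ytot : ℝ := (10 : ℝ) ^ 6 * 27 ^ 36 * (((5 : ℝ) ^ ((58 : ℝ) / 27)) ^ 213)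

/-- The total value of the word. [folklore] -/
def Vtot : ℝ := 1 * ((2 : ℝ) ^ (2 + 2 * H3)) ^ 213

/-- `X > 0`. [folklore] -/
theorem Xtot_pos : 0 < Xtot := by unfold Xtot; positivity
/-- `Y > 0`. [folklore] -/
theorem Ytot_pos : 0 < Ytot := by unfold Ytot; positivity
/-- `V > 0`. [folklore] -/
theorem Vtot_pos : 0 < Vtot := by unfold Vtot; positivity

/-- **The block value of the level-2 word**: `(V; X, Y, X)`.
[cite: LeGall2012, §6.1 and Prop. 6.2] -/
theorem hasFormatValue_lvl2Word : HasFormatValue (blockOf lvl2Word) Vtot Xtot Ytot Xtot := by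
  unfold lvl2Word Vtot Xtot Ytot
  have h5 : (0 : ℝ) ≤ 5 := by norm_num
  exact hasFormatValue_matWord.laserBlock_append cwLev2 cwLev2 cwLev2 (bigCwSq ℂ 5)
    hasFormatValue_famRep zero_le_one (by positivity) (by positivity)
    (pow_nonneg (Real.rpow_nonneg h5 _) _) (by positivity) (pow_nonneg (Real.rpow_nonneg h5 _) _)
    (by positivity) (pow_nonneg (Real.rpow_nonneg h5 _) _)

end Summit.MatrixMultiplication.MatrixMultiplication.Theorems.SaturationLadderLevelTwo

end
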